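import Literature.AnabelianGeometry.EtaleTheta.ArithThetaTowerCThetaToBirat
import Literature.AlgebraicGeometry.Frobenioids.ModelFrobenioidFunctor
import HarnessLib

/-!
# [IUTchI] Ex. 3.2 (v) at the ARITHMETIC theta tower: «`q̲_v|_{T_A} ↦ Θ̲_v|_{T_{A^Θ}}`» AS A THEOREM about the functor
# `cThetaToBirat` (GAP A item GA-06, FIELDS half of D6, file 4: the DISTINGUISHING read-outs asked by abc-iut-crit-A (β) and GA-16 (R1)/(R2))

S. Mochizuki, *Inter-universal Teichmüller Theory I* [Mochizuki2012], Ex. 3.2 (v) p.72: «natural isomorphisms `𝒪^▷_{𝒞⊢_v}(−) ⥲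
𝒪^▷_{𝒞^Θ_v}(−)` … which are compatible with the assignment `q̲_v|_{T_A} ↦ Θ̲_v|_{T_{A^Θ}}` and the natural isomorphism [induced by
`A^Θ = Ÿ_v × A → A`] `𝒪^×(T_A) ⥲ 𝒪^×(T_{A^Θ})`» [claim: Mochizuki2012, status: disputed] (D-0012 claim key; theorems about OUR terms;
nothing of the series asserted); [MochizukiFrdI2008] Thm. 5.2 (i)(ii) p.100–101, Prop. 4.4 (iv) p.83.

WHY THIS FILE (abc-iut-crit-A 21:46:37Z (β), GA-16 21:47:43Z (R1)/(R2)): the slot TYPE `TemperedThetaRestBirat` has no field relating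
`CThetaToBirat` to `theta`, so «Θ̲-compatible» must be a KERNEL-VISIBLE property of the TERM `cThetaToBirat hC hF hq`.  Here:
* (R1) `frobAt = ModelFrobenioid.zeroHom n (𝟙 A)`, `pbAt = ModelFrobenioid.zeroHom 1 g` (`rfl`); `cThetaToBirat_map` is in file 3/3.
* (R2) **`biratUnitPart hC hF hq X : B_{𝒞^Θ_v}(A^Θ) →* 𝒪^×(T^÷_{Ÿ_T × A})`**, the unit map as a NAMED homomorphism (`unitPart` of
  file 2/3 through [FrdI] Thm. 5.2 (ii) `B ≃* 𝒪^×(T^÷)`), with `unitB = toHom ∘ biratUnitPart` (`rfl`) and its divisor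
  `divHom ∘ biratUnitPart = Div_B ∘ unitPart` (`divHom_biratUnitPart`).
* (β) **`genHom hq X : T_{A^Θ} → T_{A^Θ}`**, the generating endomorphism «`q̲_v`» of the Frobenius-trivial object of `𝒞^Θ_v`
  (`deg 1`, `Div = log q̲_v`, `u = q̲_v`); **`coe_unitPart_liftGen`**: the unit part sends `q̲_v` to `Θ̲|_{Ÿ_T × A}` (NOT to the
  constant `q̲_v`); and **`cThetaToBirat_map_genHom`**: `cThetaToBirat(q̲_v) ≫ (T^÷_{Ÿ_T × A} → T^÷_{Ÿ_T}) = (T^÷_{Ÿ_T × A} → T^÷_{Ÿ_T}) ≫ Θ̲_v`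
  — a statement naming BOTH `cThetaToBirat hC hF hq` and `theta hC hF`, false for a constants-only inhabitant of the slot.
HONEST FRAMING: theorems about OUR terms over a `Prop`-valued spec; TYPED ≠ INHABITED (the term is GA-12's) ≠ proved-in-print; an
UNDISPUTED construction around [IUTchIII] Cor. 3.12, which stays OPEN by charter (D-0045) — no side taken; nothing here asserts abc
proved or refuted; count-neutral.  No instance, no notation, no `sorry`.
-/

noncomputable section

namespace Literature.AnabelianGeometry.EtaleTheta

namespace ArithThetaTower

open CategoryTheory Opposite Function Literature.AlgebraicGeometry.Frobenioids Literature.AnabelianGeometry.SemiGraphs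
  Literature.IUT.HodgeTheaters Literature.AlgebraicGeometry.Frobenioids.PadicFrd

variable {p : ℕ} [Fact p.Prime] {d : GaloisValDatum.{0} p} {P : Type} [Group P] [TopologicalSpace P]
  {T : BadLocalGroupDatum d.Gal P} {T' : RealifiedDivisorMonoids (D₀ := T.Dv) treeMonoidVocabWeak.{0}}
  {VD : FrdICatStub.{0, 0, 0} T.Dv}

/-! ## (R1) the Frobenius and pull-back parts are abc-iut-L1's `zeroHom` -/

/-- `F(n)_A` IS `ModelFrobenioid.zeroHom n (𝟙 A)`. [cite: MochizukiFrdI2008, Thm. 5.2 (i) p.100] -/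
theorem frobAt_eq_zeroHom (C : TemperedFrobenioid T' T.Dv VD) (A : T.Dv) (n : ℕ+) :
    frobAt C A n = ModelFrobenioid.zeroHom n (𝟙 A) := rfl

/-- The pull-back part over `g` IS `ModelFrobenioid.zeroHom 1 g`. [cite: MochizukiFrdI2008, Thm. 5.2 (i) p.100] -/
theorem pbAt_eq_zeroHom (C : TemperedFrobenioid T' T.Dv VD) {A B : T.Dv} (g : A ⟶ B) :
    pbAt C g = ModelFrobenioid.zeroHom 1 g := rfl

/-! ## (R2) the unit map as a named homomorphism into `𝒪^×(T^÷_{Ÿ_T × A})` -/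

section UnitHom

variable {C : TemperedFrobenioid T' T.Dv VD} {qroot : intNonzero d.k} (hC : CarrierSpec d T C)
  (hF : PreFrobenioid.IsFrobenioid C.toElem) (hq : ¬ IsUnit qroot)

/-- **`B_{𝒞^Θ_v}(A^Θ) →* 𝒪^×(T^÷_{Ÿ_T × A})`**: the unit part `x ↦ const(x) · (Θ̲|_{Ÿ_T × A} · q̲_v⁻¹)^{n(x)}` (file 2/3) through
[FrdI] Thm. 5.2 (ii) `B(Ÿ_T × A) ≃* 𝒪^×(T^÷_{Ÿ_T × A})`. ([IUTchI] Ex 3.2 (v) p.72) [claim: Mochizuki2012, status: disputed] -/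
def biratUnitPart (X : T.DTheta) :
    ((T.thetaDatum d hq).B.obj (op X) : Type) →* PreFrobenioid.BiratUnits C.toElem hF (⟨dThetaObj T X, 1⟩ : C.category) :=
  (BadLocalFrobenioid.temperedRatFnEquivBiratUnits C hF (dThetaObj T X)).toMonoidHom.comp
    ((Units.coeHom _).comp (unitPart d T hq hC X))

/-- `unitB = toHom ∘ biratUnitPart` (file 3/3's endomorphism form). ([IUTchI] Ex 3.2 (v) p.72) [claim: Mochizuki2012, status: disputed] -/
theorem unitB_eq (X : T.DTheta) (x : ((T.thetaDatum d hq).B.obj (op X) : Type)) :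
    unitB hC hF hq X x = PreFrobenioid.BiratUnits.toHom (PreFrobenioid.hasBiratSquares_of_isFrobenioid hF) (biratUnitPart hC hF hq X x) := rfl

/-- The birational divisor of the unit part is `Div_B` of the underlying rational function ([FrdI] Thm. 5.2 (ii) «Moreover»).
[cite: MochizukiFrdI2008, Thm. 5.2 (ii) p.101] -/
theorem divHom_biratUnitPart (X : T.DTheta) (x : ((T.thetaDatum d hq).B.obj (op X) : Type)) :
    PreFrobenioid.BiratUnits.divHom hF (⟨dThetaObj T X, 1⟩ : C.category) (biratUnitPart hC hF hq X x) =
      (C.divBNatTrans.app (op (dThetaObj T X))).hom (unitPart d T hq hC X x : C.ratFnFunctor.obj (op (dThetaObj T X))) :=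
  BadLocalFrobenioid.divHom_temperedRatFnEquivBiratUnits C hF (dThetaObj T X) _

/-- `cThetaToBirat` on morphisms through the named unit homomorphism. ([IUTchI] Ex 3.2 (v) p.72) [claim: Mochizuki2012, status: disputed] -/
theorem cThetaToBirat_map_eq {X Y : T.CTheta d hq} (φ : X ⟶ Y) :
    (cThetaToBirat hC hF hq).map φ =
      (PreFrobenioid.toBirat C.toElem hF (PreFrobenioid.hasBiratSquares_of_isFrobenioid hF)).map (ModelFrobenioid.zeroHom (ModelFrobenioid.degFr φ) (𝟙 (dThetaObj T X.base))) ≫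
        PreFrobenioid.BiratUnits.toHom (PreFrobenioid.hasBiratSquares_of_isFrobenioid hF) (biratUnitPart hC hF hq X.base (ModelFrobenioid.unit φ)) ≫
          (PreFrobenioid.toBirat C.toElem hF (PreFrobenioid.hasBiratSquares_of_isFrobenioid hF)).map (ModelFrobenioid.zeroHom 1 (dThetaHom T (ModelFrobenioid.baseMap φ))) :=
  rfl

/-! ## (β) «`q̲_v|_{T_A} ↦ Θ̲_v|_{T_{A^Θ}}`» for the term `cThetaToBirat hC hF hq` -/

/-- `q̲_v ∈ B_{𝒞^Θ_v}(A^Θ)`, the lift of the constant section over `(q̲_v, log q̲_v)` (abc-iut-L1-t4's `Monogenic.liftGen`).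
([IUTchI] Ex 3.2 (iv) p.71) [claim: Mochizuki2012, status: disputed] -/
abbrev qGen (X : T.DTheta) : ((T.thetaDatum d hq).B.obj (op X) : Type) :=
  PadicFrd.Monogenic.liftGen (T.thetaBase d) ((d.relEmb.restrict T.prodEquiv.inverse).isConstantSection hq) (op X)

/-- **The unit part sends `q̲_v` to `Θ̲|_{Ÿ_T × A}`** — NOT to the constant `q̲_v`: `const(q̲_v) · (Θ̲ · q̲_v⁻¹)^1 = Θ̲|_{Ÿ_T × A}`.
([IUTchI] Ex 3.2 (v) p.72) [claim: Mochizuki2012, status: disputed] -/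
theorem coe_unitPart_qGen (X : T.DTheta) :
    (unitPart d T hq hC X (qGen hq X) : C.ratFnFunctor.obj (op (dThetaObj T X))) = thetaRatFnAt hC X := by
  have h1 : unitPart d T hq hC X (qGen hq X) = (constRatFn hC (dThetaObj T X)).toHomUnits (qUnitsAt d T qroot X) *
      rhoPowGp d T hq hC X (Algebra.GrothendieckGroup.of (logqAt d T hq X ^ 1)) := by
    rw [pow_one]
    rfl
  rw [h1, rhoPowGp_of_pow, pow_one, rhoAt, mul_comm, inv_mul_cancel_right]
  rfl

/-- The same in `𝒪^×(T^÷_{Ÿ_T × A})`. ([IUTchI] Ex 3.2 (v) p.72) [claim: Mochizuki2012, status: disputed] -/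
theorem biratUnitPart_qGen (X : T.DTheta) :
    biratUnitPart hC hF hq X (qGen hq X) =
      BadLocalFrobenioid.temperedRatFnEquivBiratUnits C hF (dThetaObj T X) (thetaRatFnAt hC X) := by
  change BadLocalFrobenioid.temperedRatFnEquivBiratUnits C hF (dThetaObj T X)
    (unitPart d T hq hC X (qGen hq X) : C.ratFnFunctor.obj (op (dThetaObj T X))) = _
  rw [coe_unitPart_qGen]

/-- **`genHom hq X : T_{A^Θ} → T_{A^Θ}`** — «`q̲_v`» as the generating base-identity linear endomorphism of the Frobenius-trivial object
`T_{A^Θ} = (A^Θ, 0)` of `𝒞^Θ_v`: `(deg 1, id, Div = log q̲_v, u = q̲_v)` ([FrdI] Thm. 5.2 (i); `𝒪^▷(T_{A^Θ}) = 𝒪^× · q̲_v^ℕ`).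
([IUTchI] Ex 3.2 (v) p.72) [claim: Mochizuki2012, status: disputed] -/
def genHom (X : T.DTheta) : (⟨X, 1⟩ : T.CTheta d hq) ⟶ ⟨X, 1⟩ where
  degFr := 1
  base := 𝟙 X
  div := logqAt d T hq X
  unit := qGen hq X
  rel := by
    change (1 : Algebra.GrothendieckGroup ((T.thetaDatum d hq).Φ.obj (op X) : Type)) ^ ((1 : ℕ+) : ℕ) *
        Algebra.GrothendieckGroup.of (logqAt d T hq X) =
      pullGp (T.thetaDatum d hq).Φ (𝟙 X) 1 * Algebra.GrothendieckGroup.of (logqAt d T hq X)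
    rw [one_pow, map_one]

/-- **«`q̲_v|_{T_A} ↦ Θ̲_v|_{T_{A^Θ}}`» FOR THE TERM OF RECORD**: the image under `cThetaToBirat hC hF hq` of the generator `q̲_v` of
`𝒪^▷(T_{A^Θ})`, followed by `T^÷_{Ÿ_T × A} → T^÷_{Ÿ_T}`, is `T^÷_{Ÿ_T × A} → T^÷_{Ÿ_T}` followed by `Θ̲_v = theta hC hF` — the
Θ̲-COMPATIBILITY of the functor as a kernel statement naming both `cThetaToBirat` and `theta` (abc-iut-crit-A (β); false for a
constants-only inhabitant of the slot, whose image would intertwine with the constant `q̲_v`). ([IUTchI] Ex 3.2 (v) p.72)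
[claim: Mochizuki2012, status: disputed] -/
theorem cThetaToBirat_map_genHom (X : T.DTheta) :
    (cThetaToBirat hC hF hq).map (genHom hq X) ≫
        (PreFrobenioid.toBirat C.toElem hF (PreFrobenioid.hasBiratSquares_of_isFrobenioid hF)).map (pbAt C (T.dThetaIncl.obj X).hom) =
      (PreFrobenioid.toBirat C.toElem hF (PreFrobenioid.hasBiratSquares_of_isFrobenioid hF)).map (pbAt C (T.dThetaIncl.obj X).hom) ≫
        PreFrobenioid.BiratUnits.toHom (PreFrobenioid.hasBiratSquares_of_isFrobenioid hF) (theta hC hF) := by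
  have h1 : frobB hF X 1 = 𝟙 _ := by
    change (PreFrobenioid.toBirat C.toElem hF (PreFrobenioid.hasBiratSquares_of_isFrobenioid hF)).map (frobAt C (dThetaObj T X) 1) = _
    rw [frobAt_one, CategoryTheory.Functor.map_id]
  have h2 : pbB hF (𝟙 X) = 𝟙 _ := by
    change (PreFrobenioid.toBirat C.toElem hF (PreFrobenioid.hasBiratSquares_of_isFrobenioid hF)).map (pbAt C (dThetaHom T (𝟙 X))) = _
    rw [dThetaHom_id, pbAt_id, CategoryTheory.Functor.map_id]
  have hmap : (cThetaToBirat hC hF hq).map (genHom hq X) = unitB hC hF hq X (qGen hq X) := by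
    change frobB hF X 1 ≫ unitB hC hF hq X (qGen hq X) ≫ pbB hF (𝟙 X) = _
    rw [h1, h2, Category.id_comp, Category.comp_id]
  rw [hmap, unitB_eq, biratUnitPart_qGen]
  exact (toBirat_pbAt_comp_toHom C hF (T.dThetaIncl.obj X).hom (thetaRatFn hC)).symm

end UnitHom

end ArithThetaTower

end Literature.AnabelianGeometry.EtaleTheta

end
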